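import Summits.KontsevichZagierPeriods.KontsevichZagierPeriods.Theses.IsogenyCertificates
import Literature.NumberTheory.Transcendental.KZCalculus
import Literature.NumberTheory.Transcendental.SemialgebraicMapsProofs
import Literature.NumberTheory.EllipticCurves.RealLatticePeriod
import Summits.KontsevichZagierPeriods.KontsevichZagierPeriods.Theorems.RealPeriodSectorComplete.Negative.Strengthenings
import Summits.KontsevichZagierPeriods.KontsevichZagierPeriods.Theorems.HermiteRigidityGenusTwoCycleTransferPushforwardDimOne

/-!
# `RealPeriodSectorComplete` (stmt-KontsevichZagierPeriods-5381), line `period-ratio-branch-cov`: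
# stub `stub_branchMove`

The ONE change-of-variables move (Kontsevich–Zagier rule 2) of the line: given the two unbounded
real-sector representations `r₁ = [(e,∞), c/√P]`, `r₁' = [(e',∞), c'/√P']` (dimension `1`,
`P = x³ + Ax + B`, `P' = x³ + A'x + B'`, domains `{x : Fin 1 → ℝ | e < x 0}`), a strictly
increasing differentiable bijection `Φ : (e,∞) → (e',∞)` with `Φ' = β √(P'(Φ x)) / √(P x)` and
`ℚ`-semialgebraic graph, and `c = β c'`, the difference `[r₁] − [r₁']` is an instance of
`changeOfVariablesRel` with the lifted map `Φ̃ x = (Φ (x 0))` on `ℝ¹` and derivative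
`Φ̃' x = Φ'(x 0) • id`: `c/√P(x) = c'/√P'(Φ x) · |Φ'(x)|`.

Only the bookkeeping between `ℝ¹ = (Fin 1 → ℝ)` and `ℝ` is done here; the analytic input (the
branch `Φ` and the semialgebraicity of its graph) is a hypothesis. No new definitions; the
`ℝ¹`-calculus (`det (a • id) = a`, the chain rule for `p ↦ (φ (p 0))`) is reused from
`…Theorems.HermiteRigidityGenusTwoCycleTransferPushforwardDimOne`.
-/

noncomputable section

open MeasureTheory Set Filter
open scoped PeriodPair
open Literature.ModelTheory.ExponentialFields (IsSemialgebraic isSemialgebraic_setOf_eval_eq_zero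
  isSemialgebraic_setOf_eval_pos)
open Literature.NumberTheory.Transcendental
open Literature.NumberTheory.Transcendental.KZ
open Summit.KontsevichZagierPeriods.HermiteRigidity.GenusTwoCycleTransfer
  (hasFDerivAt_fin_one det_smul_id_fin_one)

namespace Summit.KontsevichZagierPeriods.IsogenyCertificates.RealPeriodSectorCompleteStubs.BranchMove

/-- The Jacobian identity of the move: `β c'/s = c'/s' · |β s'/s|` for `s, s', β > 0`. [folklore] -/
theorem jacobian_identity {β c' s s' : ℝ} (hs : 0 < s) (hs' : 0 < s') (hβ : 0 < β) :
    β * c' / s = c' / s' * |β * s' / s| := by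
  rw [abs_of_pos (div_pos (mul_pos hβ hs') hs)]
  field_simp

/-- The graph of the lifted map `x ↦ (Φ (x 0))` over `{x | e < x 0}`, realised via `Fin.append` in
`ℝ^{1+1}`, is the planar graph `{p | e < p 0 ∧ p 1 = Φ (p 0)}`. [folklore] -/
theorem graph_lift_eq (e : ℝ) (Φ : ℝ → ℝ) :
    {z : Fin (1 + 1) → ℝ | ∃ x ∈ {x : Fin 1 → ℝ | e < x 0},
        z = Fin.append x (fun _ : Fin 1 => Φ (x 0))} =
      {p : Fin 2 → ℝ | e < p 0 ∧ p 1 = Φ (p 0)} := by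
  ext z
  simp only [mem_setOf_eq]
  have h0 : ∀ (x y : Fin 1 → ℝ), Fin.append x y (0 : Fin 2) = x 0 := fun x y =>
    Fin.append_left x y 0
  have h1 : ∀ (x y : Fin 1 → ℝ), Fin.append x y (1 : Fin 2) = y 0 := fun x y =>
    Fin.append_right x y 0
  constructor
  · rintro ⟨x, hx, rfl⟩
    rw [h0, h1]
    exact ⟨hx, rfl⟩
  · rintro ⟨hz0, hz1⟩
    refine ⟨fun _ => z 0, hz0, ?_⟩
    funext i
    fin_cases i
    · exact (h0 (fun _ => z 0) (fun _ => Φ (z 0))).symm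
    · exact hz1.trans (h1 (fun _ => z 0) (fun _ => Φ (z 0))).symm

/-- The image of `{x | e < x 0}` under the lifted map is `{x | e' < x 0}` when
`Φ '' (e,∞) = (e',∞)`. [folklore] -/
theorem image_lift_eq {e e' : ℝ} {Φ : ℝ → ℝ} (himg : Φ '' Ioi e = Ioi e') :
    (fun (x : Fin 1 → ℝ) (_ : Fin 1) => Φ (x 0)) '' {x : Fin 1 → ℝ | e < x 0} =
      {x : Fin 1 → ℝ | e' < x 0} := by
  ext y
  simp only [mem_image, mem_setOf_eq]
  constructor
  · rintro ⟨x, hx, rfl⟩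
    have : Φ (x 0) ∈ Ioi e' := himg ▸ mem_image_of_mem Φ (mem_Ioi.2 hx)
    simpa using this
  · intro hy
    have : y 0 ∈ Φ '' Ioi e := himg.symm ▸ mem_Ioi.2 hy
    obtain ⟨t, ht, hty⟩ := this
    refine ⟨fun _ => t, ht, funext fun i => ?_⟩
    rw [Fin.fin_one_eq_zero i]
    exact hty

/-- STUB 7 of the line `period-ratio-branch-cov` (the one rule-2 move along the branch): with
`r₁ = [(e,∞), c/√P]`, `r₁' = [(e',∞), c'/√P']`, `Φ : (e,∞) → (e',∞)` a strictly increasing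
bijection with `Φ' = β √P'(Φ)/√P` and `ℚ`-semialgebraic graph, and `c = β c'`,
`[r₁] − [r₁'] ∈ changeOfVariablesRel` via `Φ̃ x = (Φ (x 0))`, `|det Φ̃'| = Φ' > 0` and
`c/√P = c'/√P'(Φ) · Φ'` (Kontsevich–Zagier 2001, §1.2, rule 2). [folklore] -/
theorem stub_branchMove : ∀ (A B A' B' : ℤ) (e e' : ℝ), (∀ x : ℝ, e < x → 0 < x ^ 3 + (A : ℝ) * x + (B : ℝ)) → (∀ x : ℝ, e' < x → 0 < x ^ 3 + (A' : ℝ) * x + (B' : ℝ)) → ∀ (β c c' : ℚ), 0 < β → c = β * c' → ∀ (Φ : ℝ → ℝ), StrictMonoOn Φ (Ioi e) → Φ '' Ioi e = Ioi e' → (∀ x : ℝ, e < x → HasDerivAt Φ ((β : ℝ) * Real.sqrt (Φ x ^ 3 + (A' : ℝ) * Φ x + (B' : ℝ)) / Real.sqrt (x ^ 3 + (A : ℝ) * x + (B : ℝ))) x) → IsSemialgebraic ℚ {p : Fin 2 → ℝ | e < p 0 ∧ p 1 = Φ (p 0)} → ∀ (r₁ r₁' : IntegralRep 1), r₁.domain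 = {x | e < x 0} → EqOn r₁.integrand (fun x => (c : ℝ) / Real.sqrt (x 0 ^ 3 + (A : ℝ) * x 0 + (B : ℝ))) r₁.domain → r₁'.domain = {x | e' < x 0} → EqOn r₁'.integrand (fun x => (c' : ℝ) / Real.sqrt (x 0 ^ 3 + (A' : ℝ) * x 0 + (B' : ℝ))) r₁'.domain → KZ.of r₁ - KZ.of r₁' ∈ changeOfVariablesRel := by
  intro A B A' B' e e' hP hP' β c c' hβ hcc' Φ hmono himg hderiv hgraph r₁ r₁' hd₁ hi₁ hd₁' hi₁'
  -- the scalar derivative `Φ'`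
  set d : ℝ → ℝ := fun t => (β : ℝ) * Real.sqrt (Φ t ^ 3 + (A' : ℝ) * Φ t + (B' : ℝ)) /
    Real.sqrt (t ^ 3 + (A : ℝ) * t + (B : ℝ)) with hd_def
  have himg₁ : r₁'.domain = (fun (x : Fin 1 → ℝ) (_ : Fin 1) => Φ (x 0)) '' r₁.domain := by
    rw [hd₁, hd₁', image_lift_eq himg]
  refine ⟨1, r₁, r₁', fun x _ => Φ (x 0), fun x => d (x 0) • ContinuousLinearMap.id ℝ (Fin 1 → ℝ),
    ?_, ?_, ?_, himg₁, ?_, rfl⟩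
  · -- (i) the graph of `Φ̃` over `r₁.domain` is the planar graph of `Φ` over `(e,∞)`
    unfold IsSemialgebraicMapOn
    rw [hd₁, graph_lift_eq]
    exact hgraph
  · -- (ii) derivative within the domain
    intro x hx
    rw [hd₁] at hx
    exact (hasFDerivAt_fin_one Φ (d (x 0)) x (hderiv (x 0) hx)).hasFDerivWithinAt
  · -- (iii) injectivity from strict monotonicity
    intro x hx y hy hxy
    rw [hd₁] at hx hy
    have h0 : Φ (x 0) = Φ (y 0) := by simpa using congr_fun hxy 0
    funext i
    rw [Fin.fin_one_eq_zero i]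
    exact hmono.injOn hx hy h0
  · -- (v) the integrand identity `c/√P(x) = c'/√P'(Φ x) · |Φ'(x)|`
    intro x hx
    have hx' : (fun _ : Fin 1 => Φ (x 0)) ∈ r₁'.domain := himg₁ ▸ mem_image_of_mem _ hx
    rw [hi₁ hx, hi₁' hx', det_smul_id_fin_one]
    rw [hd₁] at hx
    have hxe : e < x 0 := hx
    have hΦe : e' < Φ (x 0) := by
      have : Φ (x 0) ∈ Ioi e' := himg ▸ mem_image_of_mem Φ (mem_Ioi.2 hxe)
      exact this
    have hs : 0 < Real.sqrt (x 0 ^ 3 + (A : ℝ) * x 0 + (B : ℝ)) := Real.sqrt_pos.2 (hP _ hxe)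
    have hs' : 0 < Real.sqrt (Φ (x 0) ^ 3 + (A' : ℝ) * Φ (x 0) + (B' : ℝ)) :=
      Real.sqrt_pos.2 (hP' _ hΦe)
    have hβ' : (0 : ℝ) < β := by exact_mod_cast hβ
    have hcc : (c : ℝ) = (β : ℝ) * (c' : ℝ) := by rw [hcc', Rat.cast_mul]
    simp only [hd_def, hcc]
    exact jacobian_identity hs hs' hβ'

end Summit.KontsevichZagierPeriods.IsogenyCertificates.RealPeriodSectorCompleteStubs.BranchMove

end
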